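import Summits.Ventures.HSemireg.WedgeHankelRecurrenceTschirnhausNewton
import Summits.Ventures.HSemireg.WedgeHankelRecurrenceTschirnhausSeparable
import Summits.Ventures.HSemireg.WedgeHankelRecurrenceTraceDictionary

/-!
# Venture HSemireg — THE DISCRIMINANT OF AN ARBITRARY ELEMENT OF `K[X]/(m)`: for `m` monic of degree `t + 1`, any `a ∈ K[X]` and `T_a = χ(M_a)` (N117),
# **Mathlib's `Algebra.traceMatrix K (ā^0, ā^1, …, ā^t) = H_t(T_a′/T_a)`** and **`Algebra.discr K (ā^0, …, ā^t) = disc(T_a)`** (the discriminant of the power family of ANY element is the polynomial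
# discriminant of its Tschirnhaus transform — N104 is the case `a = X`), hence **`Algebra.discr K (ā^i)_i ≠ 0 ⟺ m separable ∧ a separates the roots`** (N120) — the classical test for a
# separating ∕ primitive element by a single discriminant.

HONEST FRAMING. Part of the Lean index of the computation cell `pub-hsemireg` (seat p10 gen 32, Sunday typer «UNIFORM-IN-n»).
LINEAR ALGEBRA OF HANKEL (catalecticant) MATRICES and of polynomials over a field ONLY (`Algebra.traceMatrix`, `Algebra.discr`, `Polynomial.discr`, `Matrix.charpoly`, the lineage's `hankelSq` ∕ `dualSeq`):
no variety, no cohomology theory, no sheaf, no Ext group and no semiregularity map is constructed here; nothing here says that HC / HC_CM / HC_AV holds; no Literature fact is declared or used.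
Custodian versions as in `WedgeHankelSiegelIdeal` (1/3).

WHAT IS IN THE TREE ∕ STAGED.  N119 (`WedgeHankelRecurrenceTschirnhausNewton`, № 618): `dualSeq_charpoly_mulResidueMat_derivative` (`p_j(T_a) = dualSeq m (a^j m′) 0`).  N120 (`…TschirnhausSeparable`, № 620):
`separable_charpoly_mulResidueMat_iff`.  N104 (`WedgeHankelRecurrenceTraceDictionary`): `algebraTrace_adjoinRoot_mk` (`Tr(mk a) = dualSeq m (a m′) 0`), `algebraDiscr_powerBasisAux'` (the case `a = X`:
`discr (power basis) = m.discr`).  N95 (`WedgeHankelRecurrenceDiscriminant`): `det_hankelSq_dualSeq_derivative` (`det H_t(p′/p) = p.discr`, `p` monic of degree `t + 1`).  N96: `det_hankelSq_dualSeq_derivative_ne_zero_iff`.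
Mathlib: `Algebra.traceMatrix_apply`, `Algebra.discr_def`, `Algebra.discr_zero_of_not_linearIndependent` (not used); Mathlib's discriminant theorems (`discr_powerBasis_eq_norm`, …) treat a
power BASIS; the family `(ā^i)` of an arbitrary element need not be a basis.  `rg`: no `Algebra.discr` statement for a non-generator in the tree.
THIS FILE (namespace `Summit.Ventures.HSemireg.Wedge.HankelOuter` continued; CHAINED on N119 + N120; 0 definitions):
* §702 **`traceMatrix_pow_adjoinRoot_mk`** (`traceMatrix K (fun i : Fin (t+1) => mk (a^i)) = H_t(T_a′/T_a)`), **`algebraDiscr_pow_adjoinRoot_mk`** (`Algebra.discr K (fun i => mk (a^i)) = (charpoly M_a).discr`),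
  `algebraDiscr_pow_adjoinRoot_mk_X` (`a = X` recovers N104), **`algebraDiscr_pow_adjoinRoot_mk_ne_zero_iff`** (`≠ 0 ⟺ m.Separable ∧ a` separates the roots of `φm`, any splitting `φ`),
  `algebraDiscr_pow_adjoinRoot_mk_eq_zero_of_not_separable` (`m` inseparable ⇒ every such discriminant vanishes).
Nothing Ext-side.  New names only.
-/

open Module Polynomial
open scoped Matrix Polynomial

namespace Summit.Ventures.HSemireg.Wedge.HankelOuter

open Summit.Ventures.HSemireg.Wedge Summit.Ventures.HSemireg.Wedge.Hankel

variable (K : Type*) [Field K]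

/-! ## §702. `traceMatrix` and `discr` of the powers of an arbitrary element -/

/-- **`Algebra.traceMatrix K (ā^0, …, ā^t) = H_t(T_a′/T_a)`**: the Gram matrix of Mathlib's trace form of `K[X]/(m)` on the powers of `ā = mk a` is the Hankel matrix of the Newton sums of the
Tschirnhaus transform `T_a = χ(M_a)` (`m` monic of degree `t + 1`; entry `(i, j)` is `Tr(ā^{i+j}) = dualSeq m (a^{i+j} m′) 0 = p_{i+j}(T_a)` by N104 and N119). -/
theorem traceMatrix_pow_adjoinRoot_mk {t : ℕ} {m : K[X]} (hm : m.Monic) (hmd : m.natDegree = t + 1) (a : K[X]) :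
    Algebra.traceMatrix K (fun i : Fin (t + 1) => AdjoinRoot.mk m (a ^ (i : ℕ))) = hankelSq K t (dualSeq K (mulResidueMat K t m a).charpoly (derivative (mulResidueMat K t m a).charpoly)) := by
  ext i j
  rw [Algebra.traceMatrix_apply, Algebra.traceForm_apply, ← map_mul, ← pow_add, algebraTrace_adjoinRoot_mk K hm hmd, ← dualSeq_charpoly_mulResidueMat_derivative K hm hmd a]
  rfl

/-- **`Algebra.discr K (ā^0, …, ā^t) = disc(T_a)`**: the discriminant of the power family of ANY element `ā` of `K[X]/(m)` is the polynomial discriminant of its Tschirnhaus transform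
(`m` monic of degree `t + 1`; N95's `det H_t(p′/p) = disc p` for the monic `T_a`). -/
theorem algebraDiscr_pow_adjoinRoot_mk {t : ℕ} {m : K[X]} (hm : m.Monic) (hmd : m.natDegree = t + 1) (a : K[X]) :
    Algebra.discr K (fun i : Fin (t + 1) => AdjoinRoot.mk m (a ^ (i : ℕ))) = (mulResidueMat K t m a).charpoly.discr := by
  classical
  rw [Algebra.discr_def, traceMatrix_pow_adjoinRoot_mk K hm hmd a, det_hankelSq_dualSeq_derivative K (Matrix.charpoly_monic _) (charpoly_mulResidueMat_natDegree K t m a)]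

/-- The case `a = X` recovers N104: `Algebra.discr K (x̄^i)_i = disc m`. -/
theorem algebraDiscr_pow_adjoinRoot_mk_X {t : ℕ} {m : K[X]} (hm : m.Monic) (hmd : m.natDegree = t + 1) :
    Algebra.discr K (fun i : Fin (t + 1) => AdjoinRoot.mk m ((Polynomial.X : K[X]) ^ (i : ℕ))) = m.discr := by
  rw [algebraDiscr_pow_adjoinRoot_mk K hm hmd, charpoly_mulResidueMat_X K hm hmd]

/-- **`Algebra.discr K (ā^0, …, ā^t) ≠ 0 ⟺ m` is separable AND `a` separates the roots of `φm`** (`m` monic of degree `t + 1`, `φ` any embedding under which `m` splits): Hermite's criterion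
for `T_a` (N96 ∕ N95) and N120's separability criterion — the one-discriminant test for a separating (primitive) element. -/
theorem algebraDiscr_pow_adjoinRoot_mk_ne_zero_iff [DecidableEq K] {L : Type*} [Field L] [DecidableEq L] (φ : K →+* L) {t : ℕ} {m : K[X]} (hm : m.Monic) (hmd : m.natDegree = t + 1)
    (hs : (m.map φ).Splits) (a : K[X]) :
    Algebra.discr K (fun i : Fin (t + 1) => AdjoinRoot.mk m (a ^ (i : ℕ))) ≠ 0 ↔ m.Separable ∧ ∀ x ∈ (m.map φ).roots, ∀ y ∈ (m.map φ).roots, (a.map φ).eval x = (a.map φ).eval y → x = y := by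
  classical
  rw [Algebra.discr_def, traceMatrix_pow_adjoinRoot_mk K hm hmd a]
  exact det_hankelSq_tschirnhaus_ne_zero_iff K φ hm hmd hs a

/-- If `m` is NOT separable, the discriminant of the power family of EVERY element of `K[X]/(m)` vanishes. -/
theorem algebraDiscr_pow_adjoinRoot_mk_eq_zero_of_not_separable {t : ℕ} {m : K[X]} (hm : m.Monic) (hmd : m.natDegree = t + 1) (hsep : ¬ m.Separable) (a : K[X]) :
    Algebra.discr K (fun i : Fin (t + 1) => AdjoinRoot.mk m (a ^ (i : ℕ))) = 0 := by
  classical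
  by_contra h
  exact hsep ((algebraDiscr_pow_adjoinRoot_mk_ne_zero_iff K (algebraMap K m.SplittingField) hm hmd (SplittingField.splits m) a).mp h).1

end Summit.Ventures.HSemireg.Wedge.HankelOuter
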